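import Mathlib
import Summits.Ventures.HodgeRepro.Tier4.Line4.TailGlueRatio
import Summits.Ventures.HodgeRepro.Tier4.Line4.TransporterSeparation
import Summits.Ventures.HodgeRepro.Tier4.Line4.SuppMeasureFinite
import Summits.Ventures.HodgeRepro.Tier4.Line4.OrbitProper

/-!
# Tier4/Line4/TailPieces — C-L4-7B-GENERIC: the generic-plane layer of the (7b) assembly

Blind re-derivation cell `pub-hodge-repro`, Tier 4 «prove the step» (README §9–§10), LINE L4, seat t4-x2 (g5, reserve
wall-breaker; plan-4 g6's cut S15846, taken S15849).  Tree path `lean/Summits/Ventures/HodgeRepro/Tier4/Line4/TailPieces.lean`.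
Imports `Line4/TailGlueRatio` (p711548), L2-p3's `Line4/TransporterSeparation` (p707094: `exists_level_separates_transporter`),
L2-p1's `Line4/SuppMeasureFinite` (`suppMeasure_ne_top`), L2-p3's `Line4/OrbitProper` (`hasProperFinOrbit_of_isLinRegular`).
Mathlib-level; no literature; no `def`.

WHAT.  `exists_levelFamily_fibreDominated_of_pieces` is `exists_levelFamily_fibreDominated_of_displays_ratio` (TailGlueRatio)
on an ARBITRARY plane `W`, with every binder the tree discharges BY NAME folded in, and every remaining piece stated
LEVEL-INDEXED (at the levels `p ^ M`) so that the separation threshold `n₁` is chosen INSIDE the proof (from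
`exists_level_separates_transporter`) and the level sequence `lev n := p ^ (n + n₁)` is produced by the theorem:
* (S-SEP) BY NAME: `exists_level_separates_transporter (hgen : IsGenuineRow W) γ₀ (hlin : IsLinRegular W γ₀) p hp`;
* `hfin` BY NAME: `suppMeasure_ne_top (hDZc) (hN) (hasProperFinOrbit_of_isLinRegular hdet hgen γ₀ hlin)`;
* `hunit` BY NAME: RatioGlue's `unit_of_currency_of_beta` from the currency match `hcur` (CurrencyMatch, L1-p4) and the (β)
  unit bound `hβ` (UnitBeta, L2-p2) — both bound as HYPOTHESES in their posted level-indexed forms until they land by name;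
* (S-IDX), (S-MAIN), (S-RATIO)'s cover: by name through TailGlueMain / TailGlueRatio;
* the scale `hg` along `p ^ (n + n₁)`: `Tendsto gth atTop atTop` composed with `tendsto_pow_atTop_atTop_of_one_lt hp.one_lt`
  and `tendsto_add_atTop_nat n₁` (L3-p2's SparsityScale shape);
* the level family is rewritten from `ffinMuNat … lev (lev n)` to `ffinMu … (p ^ (n + n₁))` by `ffinMuNat_lev`, so (S-SPARSE)
  and `ChainInputs` are taken at the plain level-`p ^ M` family.

THE CENSUS — what stays a binder of the generic layer (the (7b) residual of record at this layer; each a displayed hypothesis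
of a lemma, never a wall binder):
(i) plane facts: `hdet : W.B.det ≠ 0`, `hgen : IsGenuineRow W`, `hreg : IsRegularRational W γ₀`, `hlin : IsLinRegular W γ₀`
(the bridge `IsLinRegular → IsRegularRational` is the instance's, LinConcat L781), `[IsFiniteMeasure νinf]`, `[IsFiniteMeasure νinf']`,
the Haar normalisations `hcμ hcμ' hcμ₀`, `hDZf hfd hDZc` (the `Z(k)`-domain), the level prime `p` with `exists_levelPrime`'s
integrality clause `hγ₀`;
(ii) the (F) pieces: `hproj` ((F-c) ProjSetCompactBound, L1-p1), `hcur` (CurrencyMatch, L1-p4), `hβ` (UnitBeta, L2-p2);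
(iii) the displays: `hv` (positivity of the unit — from the (β) bound and the openness of the level sets, L2-p2),
`hcount : SublevelCount₀ W S` ((S-COUNT) ⇐ VolumeGrowth), `hR`/`hg` ((S-SPARSE): L1-p3's `_smul_seesaw'` + the fibre bridge
+ SparsityScale), `hnv` ((S-FIN-NV): L4-x2's FinNVGlue ⇐ PHASE-AT-P × `awayOrbital ≠ 0` × MainTermSplit), `hchain`
(`ChainInputs`: L2-p3's `chainInputs_of_pieces` — nine global clauses theorems, FIN by ChainInputsFin, `hB1` + ARCH
(ConvInfRegularity) displays), `harch` (the archimedean non-vanishing of (7a)).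

Nothing here says anything about the status of the Hodge conjecture for CM abelian varieties, which is NOT proved
(HC_CM is NOT proved by anyone in this repository).
-/

set_option autoImplicit false

noncomputable section

namespace Summit.Ventures.HodgeRepro.Tier4.Line4

open MeasureTheory Topology Filter NumberField IsDedekindDomain Summit.Ventures.HodgeRepro.Tier4
  Summit.Ventures.HodgeRepro.Tier4.Common Summit.Ventures.HodgeRepro.Tier4.Line1
  Summit.Ventures.HodgeRepro.Tier4.Line1.RTF Summit.Ventures.HodgeRepro.Tier4.Line4.L1Class

open scoped NumberField NNReal ENNReal Pointwise

section Generic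

variable {k : Type} [Field k] [NumberField k] (W : PlaneData k) [MeasurableSpace (GA W)] [BorelSpace (GA W)]
  (R : RTFData W) (μ : Measure (GA W)) [μ.IsHaarMeasure] [R.μT.IsHaarMeasure] [R.μT'.IsHaarMeasure]
  (DG : Set (GA W)) (fdG : IsFundamentalDomain (rationalPoints W) DG μ) (compG : IsCompact (closure DG))
  (compT : IsCompact (closure R.DT)) (compT' : IsCompact (closure R.DT'))

/-- **C-L4-7B-GENERIC — the generic-plane layer of (7b)**: the existential package of `TailForArch'''` from the pieces,
with the separation threshold chosen inside (`lev n := p ^ (n + n₁)`), every remaining input level-indexed. -/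
theorem exists_levelFamily_fibreDominated_of_pieces [MeasurableMul (torusT W)] [MeasurableMul (torusT' W)]
    (hRH : R.IsHaar)
    (hc : Continuous R.chi) (hu : ∀ a, ‖R.chi a‖ = 1) (hc' : Continuous R.chi') (hu' : ∀ a, ‖R.chi' a‖ = 1)
    (q : QuadData k) (g g' : Matrix (Fin 4) (Fin 4) k) (w₀ : InfinitePlace k) (eP eM eP' eM' : InfinitePlace k → ℤ)
    (hdet : W.B.det ≠ 0) (hgen : IsGenuineRow W)
    (γ₀ : rationalPoints W) (hreg : IsRegularRational W γ₀) (hlin : IsLinRegular W γ₀)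
    (νinf : Measure (torusInf W)) [νinf.IsHaarMeasure] [IsFiniteMeasure νinf]
    (νf : Measure (torusFin W)) [νf.IsHaarMeasure]
    (c : ℝ≥0) (hc0 : 0 < c) (hcμ : R.μT = c • Measure.map (torusSplit W).symm (νinf.prod νf))
    (νinf' : Measure (torusInf' W)) [νinf'.IsHaarMeasure] [IsFiniteMeasure νinf']
    (νf' : Measure (torusFin' W)) [νf'.IsHaarMeasure]
    (c' : ℝ≥0) (hc0' : 0 < c') (hcμ' : R.μT' = c' • Measure.map (torusSplit' W).symm (νinf'.prod νf'))
    (DZf : Set (torusFin W)) (hDZf : MeasurableSet DZf) (hfd : IsFundamentalDomain (centreFin W) DZf νf)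
    (hDZc : ∀ C : Set (torusFin W), IsCompact C → IsCompact (closure (DZf ∩ (C * (ZfIn W : Set (torusFin W))))))
    (μinf : Measure (infinitePart W)) [μinf.IsHaarMeasure] (μ₀ : Measure (finitePart W)) [μ₀.IsHaarMeasure]
    (c₀ : ℝ≥0) (hc₀ : 0 < c₀) (hcμ₀ : μ = c₀ • Measure.map (gaSplit W).symm (μinf.prod μ₀))
    (finf : GA W → ℂ)
    (hfinf : IsArchCoeffD W (Setting.ofAdelicData W R μ DG fdG compG compT compT') R q g g' w₀ eP eM eP' eM'
      (γ₀ : GA W) νinf νinf' finf)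
    {e : GA W → ℂ} (he : IsInfFactor W e)
    (hequiv : ∀ (w : InfinitePlace k) (κ : GA W), κ ∈ localTorusAt' W w → ∀ x,
      e (x * κ) = weightAt' W q w g g' 0 κ ^ (-eP' w) * weightAt' W q w g g' 1 κ ^ (-eM' w) * e x)
    (harch : L1Class.archFactor W R (convInf W μinf finf e) (γ₀ : GA W) νinf νinf' ≠ 0)
    (p : ℕ) (hp : p.Prime)
    (hγ₀ : ∀ v : HeightOneSpectrum (𝓞 k), natSize k v p < 1 → ∀ i j : Fin 4,
      Valued.v (finPart k (GA.mat W (γ₀ : GA W) i j) v) ≤ 1 ∧ Valued.v (finPart k (GA.mat W (γ₀ : GA W)⁻¹ i j) v) ≤ 1)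
    -- the (F) pieces, level-indexed
    (u : ℕ → ℝ≥0∞) (κ : ℝ≥0∞) (hκ : κ ≠ ⊤)
    (hproj : ∀ (M : ℕ) (γ : GA W), νf (finTf W '' closure R.DT ∩ projSet W (γ₀ : GA W) (p ^ M) γ) ≤ κ * u M)
    (v : ℕ → ℝ≥0∞) (M₃ : ℝ≥0∞) (hM₃ : M₃ ≠ ⊤) (hcur : ∀ M, u M ≤ M₃ * v M)
    (M₄ : ℝ≥0∞) (hM₄ : M₄ ≠ ⊤)
    (hβ : ∀ M : ℕ, v M * νf' (levelTf' W (p ^ M)) ≤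
      M₄ * suppMeasure W νf νf' (γ₀ : GA W) DZf (p ^ M) (γ₀ : GA W))
    -- (S-UNIT) positivity, (S-COUNT), (S-SPARSE), (S-FIN-NV), `ChainInputs` — level-indexed
    (hv : ∀ M : ℕ, 0 < (suppMeasure W νf νf' (γ₀ : GA W) DZf (p ^ M) (γ₀ : GA W)).toReal)
    (hcount : SublevelCount₀ W (Setting.ofAdelicData W R μ DG fdG compG compT compT'))
    (gth : ℕ → ℝ) (hg : Tendsto gth atTop atTop)
    (hR : ∀ (M : ℕ) (γ : (Setting.ofAdelicData W R μ DG fdG compG compT compT').Gk),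
      (Setting.ofAdelicData W R μ DG fdG compG compT compT').orbitOf γ ∉
        ({(Setting.ofAdelicData W R μ DG fdG compG compT compT').orbitOf γ₀} :
          Finset (Setting.ofAdelicData W R μ DG fdG compG compT compT').Orbit) →
      (∃ t ∈ R.DT, ∃ t' ∈ R.DT',
        (Setting.ofAdelicData W R μ DG fdG compG compT compT').conv
          (prodFn W finf (ffinMu W μ₀ (γ₀ : GA W) (p ^ M))) (testNat W e (p ^ M))
          ((t : GA W)⁻¹ * γ * (t' : GA W)) ≠ 0) →
      gth (p ^ M) ≤ archDist W (γ : GA W))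
    (hnv : ∃ δ : ℝ, 0 < δ ∧ ∃ M₀ : ℕ, ∀ M ≥ M₀,
      δ * (suppMeasure W νf νf' (γ₀ : GA W) DZf (p ^ M) (γ₀ : GA W)).toReal ≤
        ‖∫ b in DZf, R.chi b * innerFin W R (levelDC W (γ₀ : GA W) (p ^ M)) (γ₀ : GA W) νf' b ∂νf‖)
    (hchain : ∀ M : ℕ, ChainInputs W R γ₀ νinf νf νinf' νf' DZf
      ((Setting.ofAdelicData W R μ DG fdG compG compT compT').conv
        (prodFn W finf (ffinMu W μ₀ (γ₀ : GA W) (p ^ M))) (testNat W e (p ^ M)))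
      (fun x => (c₀ : ℂ) * convInf W μinf finf e x) (levelDC W (γ₀ : GA W) (p ^ M))) :
    ∃ lev : ℕ → ℕ, (∀ n, lev n ≠ 0) ∧
    ∃ ffin f₂ : ℕ → GA W → ℂ, TailFamily' W q g g' eP' eM' (γ₀ : GA W) ffin f₂ ∧
      ∃ E : Finset (Setting.ofAdelicData W R μ DG fdG compG compT compT').Orbit,
        (Setting.ofAdelicData W R μ DG fdG compG compT compT').orbitOf γ₀ ∈ E ∧
        FibreDominatedFrom (Setting.ofAdelicData W R μ DG fdG compG compT compT') R.chi R.chi' E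
          (fun n => (Setting.ofAdelicData W R μ DG fdG compG compT compT').conv
            (prodFn W finf (ffin (lev n))) (f₂ (lev n))) := by
  -- (S-SEP) by name: the threshold `n₁`
  obtain ⟨n₁, hsep⟩ := exists_level_separates_transporter W hgen γ₀ hlin p hp
  have hpN : ∀ N : ℕ, p ^ (N + n₁) ≠ 0 := fun N => pow_ne_zero _ hp.ne_zero
  -- the family at level `p ^ (N + n₁)` in the two spellings
  have hff : ∀ N : ℕ, ffinMuNat W μ₀ (γ₀ : GA W) (fun n => p ^ (n + n₁)) (p ^ (N + n₁)) =
      ffinMu W μ₀ (γ₀ : GA W) (p ^ (N + n₁)) := fun N =>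
    ffinMuNat_lev W μ₀ (γ₀ : GA W) (lev := fun n => p ^ (n + n₁)) (n := N) (hpN N)
  -- `hfin` by name
  have hprop : HasProperFinOrbit W (γ₀ : GA W) := hasProperFinOrbit_of_isLinRegular W hdet hgen γ₀ hlin
  have hfin : ∀ n, suppMeasure W νf νf' (γ₀ : GA W) DZf (p ^ (n + n₁)) (γ₀ : GA W) ≠ ⊤ := fun n =>
    suppMeasure_ne_top W νf νf' (γ₀ : GA W) DZf hDZc (hpN n) hprop
  -- `hunit` by name from the currency match and the (β) bound
  have hunit : ∀ n, u (n + n₁) * νf' (levelTf' W (p ^ (n + n₁))) ≤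
      (M₃ * M₄) * suppMeasure W νf νf' (γ₀ : GA W) DZf (p ^ (n + n₁)) (γ₀ : GA W) := fun n =>
    unit_of_currency_of_beta W νf νf' (γ₀ : GA W) DZf (fun n => p ^ (n + n₁)) (fun n => u (n + n₁))
      (fun n => v (n + n₁)) M₃ M₄ (fun n => hcur (n + n₁)) (fun n => hβ (n + n₁)) n
  -- the scale along the level sequence
  have hg' : Tendsto (fun N : ℕ => gth (p ^ (N + n₁))) atTop atTop :=
    hg.comp ((tendsto_pow_atTop_atTop_of_one_lt hp.one_lt).comp (tendsto_add_atTop_nat n₁))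
  -- (S-SPARSE) at the `ffinMuNat` spelling
  have hR' : ∀ (N : ℕ) (γ : (Setting.ofAdelicData W R μ DG fdG compG compT compT').Gk),
      (Setting.ofAdelicData W R μ DG fdG compG compT compT').orbitOf γ ∉
        ({(Setting.ofAdelicData W R μ DG fdG compG compT compT').orbitOf γ₀} :
          Finset (Setting.ofAdelicData W R μ DG fdG compG compT compT').Orbit) →
      (∃ t ∈ R.DT, ∃ t' ∈ R.DT',
        (Setting.ofAdelicData W R μ DG fdG compG compT compT').conv
          (prodFn W finf (ffinMuNat W μ₀ (γ₀ : GA W) (fun n => p ^ (n + n₁)) (p ^ (N + n₁))))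
          (testNat W e (p ^ (N + n₁))) ((t : GA W)⁻¹ * γ * (t' : GA W)) ≠ 0) →
      gth (p ^ (N + n₁)) ≤ archDist W (γ : GA W) := by
    intro N γ h1 h2
    rw [hff N] at h2
    exact hR (N + n₁) γ h1 h2
  -- (S-FIN-NV) re-indexed
  have hnv' : ∃ δ : ℝ, 0 < δ ∧ ∃ N₀ : ℕ, ∀ N ≥ N₀,
      δ * (suppMeasure W νf νf' (γ₀ : GA W) DZf (p ^ (N + n₁)) (γ₀ : GA W)).toReal ≤
        ‖∫ b in DZf, R.chi b * innerFin W R (levelDC W (γ₀ : GA W) (p ^ (N + n₁))) (γ₀ : GA W) νf' b ∂νf‖ := by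
    obtain ⟨δ, hδ, M₀, h⟩ := hnv
    exact ⟨δ, hδ, M₀, fun N hN => h (N + n₁) (le_trans hN (Nat.le_add_right N n₁))⟩
  -- `ChainInputs` at the `ffinMuNat` spelling
  have hchain' : ∀ N : ℕ, ChainInputs W R γ₀ νinf νf νinf' νf' DZf
      ((Setting.ofAdelicData W R μ DG fdG compG compT compT').conv
        (prodFn W finf (ffinMuNat W μ₀ (γ₀ : GA W) (fun n => p ^ (n + n₁)) (p ^ (N + n₁))))
        (testNat W e (p ^ (N + n₁))))
      (fun x => (c₀ : ℂ) * convInf W μinf finf e x) (levelDC W (γ₀ : GA W) (p ^ (N + n₁))) := by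
    intro N
    rw [hff N]
    exact hchain (N + n₁)
  exact exists_levelFamily_fibreDominated_of_displays_ratio W R μ DG fdG compG compT compT' hRH hc hu hc' hu' q g g'
    w₀ eP eM eP' eM' γ₀ hreg νinf νf c hc0 hcμ νinf' νf' c' hc0' hcμ' DZf hDZf hfd μinf μ₀ c₀ hc₀ hcμ₀ finf hfinf he
    hequiv harch p n₁ hp hγ₀ hsep (fun n => u (n + n₁)) κ hκ (fun n γ => hproj (n + n₁) γ) (M₃ * M₄)
    (ENNReal.mul_ne_top hM₃ hM₄) hunit hfin (fun N => hv (N + n₁)) hcount (fun N => gth (p ^ (N + n₁))) hg'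
    hR' hnv' hchain'

end Generic

end Summit.Ventures.HodgeRepro.Tier4.Line4

end
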